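import Mathlib
import HarnessLib
import Summits.HubbardSuperconductivity.HubbardSuperconductivity.Theorems.KLProgrammeKLRegimeEnginePairTransferOutClassFrameShift
import Summits.HubbardSuperconductivity.HubbardSuperconductivity.Theorems.KLProgrammeKLRegimeEngineV8DefsHshiftC
import Summits.HubbardSuperconductivity.HubbardSuperconductivity.Theorems.KLProgrammeKLRegimeEngineV8DefsQ9c

/-!
# Route `KLProgramme` — ENGINE item stmt-HubbardSuperconductivity-20437 `KLRegimeEngineV17F2`, stub (c) value lane: the `hshift` binder from a frame response
# with a FIRST-ORDER and a SECOND-ORDER share (located «(c)-HSHIFT-ORDER1»; cell gate-hubbard-kl, seat gate-hubbard-kl-p2 g24)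

WHY.  k3c2-p2's `hshift_of_frameResponse(_hist)` (…EnginePairTransferOutClassFrameShift, p666917) turns `‖𝒞[K₁] − 𝒞[K₀]‖ ≤ ℓ·frameDist K₁ K₀` with
`ℓ ≤ cℓ·(Klam·U)²/Λ` (a SECOND-order response coefficient) into `≤ frameShiftBar P Q U (n+1)` under the U-door `512·cℓ·Gfr₀·|U| ≤ Q.CR`.  The four-leg
kernel of the scale-`n` one-shot action is frame-dependent ALREADY AT FIRST ORDER in `U`: absorbing the counterterm `𝒩_K` dresses every external leg by
`m_K = (1 + Ψ_K κ_K)⁻¹` (`effAction_normalCovariance_add_diagQuadratic_of_ne_zero`), and `m_K ≠ 1` at every leg above the scale-`n` shell — which the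
bare ball `klBall L μ 0` of (E2-F2) contains for `n ≥ 1`.  So the dressing share of p2's response (`600·N₄′/Λ_n`, …FrameShiftResponseFourLegDressing) is
`ℓ₁ ∝ Klam·U/Λ`, unhostable by a constant `cℓ` in the second-order slot as `U → 0`.  It is nevertheless `U²·4^{−n}`-small AFTER multiplication by
`frameDist ≤ Gfr₀·|U|·4^{−2n}`: `ℓ₁·fd ≤ 128·cℓ₁·Klam·Gfr₀·U²·4^{−n}`, inside `frameShiftBar = Q.CR·(Klam·U)²·4^{−(n+1)}` as soon as
`1024·cℓ₁·Gfr₀ ≤ Q.CR·Klam` — a U-FREE row, true at every raise of `klEngQ8 P R` for any `cℓ₁ ≤ 2⁴⁰` (`Q.CR ≥ 2⁶⁰·Psq²·Rsq²`, `Gfr₀ ≤ Rsq`, `Klam ≥ 1`).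

* §1 **`hshift_of_frameResponse_orders`**: `‖a − b‖ ≤ (ℓ₁ + ℓ₂)·frameDist K₁ K₀`, `ℓ₁ ≤ cℓ₁·Klam·|U|/Λₙ₊₁`, `ℓ₂ ≤ cℓ₂·(Klam·U)²/Λₙ₊₁`, the (I-F) jets
  `frameDist K₁ K₀ ≤ Gfr₀·uPow 0 U·4^{(0−2)n}`, doors `1024·cℓ₁·Gfr₀ ≤ Q.CR·Klam` and `1024·cℓ₂·Gfr₀·|U| ≤ Q.CR` ⇒ `‖a − b‖ ≤ frameShiftBar P Q U (n+1)`;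
  **`hshift_of_frameResponse_orders_hist`**: the history-keyed form at the (c) closer's index (as p666917's `_hist`).
* §2 the doors BY NAME: **`hshift_door_order1_of_le`** (`P.WF → R.WF → (klEngQ8 P R).IsRaiseOf Q → cℓ₁ ≤ 2⁴⁰ → 1024·cℓ₁·Gfr₀ ≤ Q.CR·Klam`, U-free, no
  render entry) and **`hshift_door_order2_klHshiftC_of_le_klEngU₀4`** (`1024·klHshiftC·Gfr₀·|U| ≤ Q.CR` below `klEngU₀4`, via `klShiftU (2·klHshiftC) =
  1/(2¹⁰¹+1) ≥ klEngU₀4`; the `512` twin is p2 g23's `hshift_door_klHshiftC_of_le_klEngU₀4`).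
Arithmetic only; nothing about the model is asserted; the sizes behind `ℓ₁, ℓ₂` are the E-lineage's; nothing here asserts (c), any stub of 20437, K3, the
margin or superconductivity.  References: BGM 2006 §2.3 (2.21)–(2.24), §3 (3.3) [cite: BenfattoGiulianiMastropietro2006].
-/

noncomputable section

namespace Summit.HubbardSuperconductivity.HubbardSuperconductivity.Theorems.KLRegimeSplit

set_option linter.dupNamespace false -- summit = problem name (single-conjunct summit), D-0017

open Real Finset Literature.MathematicalPhysics.QuantumLattice Literature.Probability.LatticeModels
open Summit.HubbardSuperconductivity.HubbardSuperconductivity.Theorems.KLProgrammeLegKernels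
open Summit.HubbardSuperconductivity.HubbardSuperconductivity.Theorems.EngineV8

/-! ## §1 `hshift` from a two-order frame response -/

/-- **`hshift` FROM A FRAME RESPONSE WITH A FIRST- AND A SECOND-ORDER SHARE**: `‖a − b‖ ≤ (ℓ₁ + ℓ₂)·frameDist K₁ K₀`,
`ℓ₁ ≤ cℓ₁·(Klam·|U|)/Λₙ₊₁`, `ℓ₂ ≤ cℓ₂·(Klam·U)²/Λₙ₊₁`, `frameDist K₁ K₀ ≤ Gfr₀·uPow 0 U·4^{(0−2)n}`, `0 ≤ Gfr₀, Klam, cℓ₁, cℓ₂`, and the two doors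
`1024·cℓ₁·Gfr₀ ≤ Q.CR·Klam` (U-free), `1024·cℓ₂·Gfr₀·|U| ≤ Q.CR` ⇒ `‖a − b‖ ≤ frameShiftBar P Q U (n+1)` (each share takes half of `Q.CR`). -/
theorem hshift_of_frameResponse_orders {P : SplitConsts} {Q : EngConsts} {R : RenConsts} {U : ℝ} {a b : ℂ} {ℓ₁ ℓ₂ cℓ₁ cℓ₂ : ℝ}
    {K₁ K₀ : TrigPolyC4v} (n : ℕ)
    (hresp : ‖a - b‖ ≤ (ℓ₁ + ℓ₂) * frameDist K₁ K₀)
    (hℓ₁ : ℓ₁ ≤ cℓ₁ * (P.Klam * |U|) / klScale klE0 (n + 1)) (hℓ₂ : ℓ₂ ≤ cℓ₂ * (P.Klam * U) ^ 2 / klScale klE0 (n + 1))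
    (hdist : frameDist K₁ K₀ ≤ R.Gfr 0 * uPow 0 U * (4 : ℝ) ^ ((((0 : ℕ) : ℤ) - 2) * (n : ℤ))) (hG0 : 0 ≤ R.Gfr 0) (hKlam : 0 ≤ P.Klam)
    (hcℓ₁ : 0 ≤ cℓ₁) (hcℓ₂ : 0 ≤ cℓ₂) (hdoor₁ : 1024 * cℓ₁ * R.Gfr 0 ≤ Q.CR * P.Klam) (hdoor₂ : 1024 * cℓ₂ * R.Gfr 0 * |U| ≤ Q.CR) :
    ‖a - b‖ ≤ frameShiftBar P Q U (n + 1) := by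
  have hfd : 0 ≤ frameDist K₁ K₀ := frameDist_nonneg K₁ K₀
  have hΛ := klth_klScale_pos (n + 1)
  rw [zpow_jets_zero] at hdist
  have hu : uPow 0 U = |U| := by simp [uPow]
  rw [hu] at hdist
  have hD0 : 0 ≤ R.Gfr 0 * |U| * (((4 : ℝ) ^ n)⁻¹ * ((4 : ℝ) ^ n)⁻¹) := by positivity
  have hL0 : 0 ≤ cℓ₁ * (P.Klam * |U|) / klScale klE0 (n + 1) + cℓ₂ * (P.Klam * U) ^ 2 / klScale klE0 (n + 1) := by positivity
  have h1 : ‖a - b‖ ≤ (cℓ₁ * (P.Klam * |U|) / klScale klE0 (n + 1) + cℓ₂ * (P.Klam * U) ^ 2 / klScale klE0 (n + 1)) *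
      (R.Gfr 0 * |U| * (((4 : ℝ) ^ n)⁻¹ * ((4 : ℝ) ^ n)⁻¹)) :=
    hresp.trans ((mul_le_mul_of_nonneg_right (add_le_add hℓ₁ hℓ₂) hfd).trans (mul_le_mul_of_nonneg_left hdist hL0))
  unfold frameShiftBar
  rw [div_eq_mul_inv, div_eq_mul_inv, inv_klScale_succ_eq] at h1
  have hUU : |U| * |U| = U ^ 2 := by rw [abs_mul_abs_self, sq]
  have e : (cℓ₁ * (P.Klam * |U|) * (32 * (4 : ℝ) ^ (n + 1)) + cℓ₂ * (P.Klam * U) ^ 2 * (32 * (4 : ℝ) ^ (n + 1))) *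
        (R.Gfr 0 * |U| * (((4 : ℝ) ^ n)⁻¹ * ((4 : ℝ) ^ n)⁻¹)) =
      ((1024 * cℓ₁ * R.Gfr 0) * (P.Klam * (|U| * |U|)) + (1024 * cℓ₂ * R.Gfr 0 * |U|) * (P.Klam * U) ^ 2) / 2 * ((4 : ℝ)⁻¹) ^ (n + 1) := by
    rw [inv_pow, pow_succ, pow_succ]
    field_simp
    ring
  rw [e, hUU] at h1
  have hKU : 0 ≤ P.Klam * U ^ 2 := by positivity
  have hK2 : 0 ≤ (P.Klam * U) ^ 2 := sq_nonneg _
  have h2 : (1024 * cℓ₁ * R.Gfr 0) * (P.Klam * U ^ 2) + (1024 * cℓ₂ * R.Gfr 0 * |U|) * (P.Klam * U) ^ 2 ≤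
      Q.CR * P.Klam * (P.Klam * U ^ 2) + Q.CR * (P.Klam * U) ^ 2 :=
    add_le_add (mul_le_mul_of_nonneg_right hdoor₁ hKU) (mul_le_mul_of_nonneg_right hdoor₂ hK2)
  have h3 : (Q.CR * P.Klam * (P.Klam * U ^ 2) + Q.CR * (P.Klam * U) ^ 2) / 2 = Q.CR * (P.Klam * U) ^ 2 := by ring
  have h4n : 0 ≤ ((4 : ℝ)⁻¹) ^ (n + 1) := by positivity
  calc ‖a - b‖ ≤ _ := h1
    _ ≤ (Q.CR * P.Klam * (P.Klam * U ^ 2) + Q.CR * (P.Klam * U) ^ 2) / 2 * ((4 : ℝ)⁻¹) ^ (n + 1) := by gcongr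
    _ = Q.CR * (P.Klam * U) ^ 2 * ((4 : ℝ)⁻¹) ^ (n + 1) := by rw [h3]

section Model

variable {L M : ℕ} [NeZero L] [NeZero M] {G : GeoConsts} {P : SplitConsts} {Q : EngConsts} {R : RenConsts} {β U μ : ℝ} {n : ℕ}

/-- **THE TWO-ORDER `hshift` AT THE (c) CLOSER'S INDEX, history-keyed**: `HistP klPredsV17F2 … 0 n` (the renorm slot's (I-F) jets at every `m < n`),
`1 ≤ n`, `0 ≤ Gfr₀`, `0 ≤ Klam`, a response `‖𝒞ₙ[Kₙ] − 𝒞ₙ[Kₙ₋₁]‖ ≤ (ℓ₁ + ℓ₂)·frameDist Kₙ Kₙ₋₁` with `ℓ₁ ≤ cℓ₁·Klam·|U|/Λₙ` (first order: the external-leg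
dressing share) and `ℓ₂ ≤ cℓ₂·(Klam·U)²/Λₙ` (second order: loop and tree shares), and the doors `1024·cℓ₁·Gfr₀ ≤ Q.CR·Klam`, `1024·cℓ₂·Gfr₀·|U| ≤ Q.CR`
⇒ `‖𝒞ₙ[Kₙ] − 𝒞ₙ[Kₙ₋₁]‖ ≤ frameShiftBar P Q U n`. -/
theorem hshift_of_frameResponse_orders_hist (hhist : HistP klPredsV17F2 L M G P Q R β U μ 0 n) (hn1 : 1 ≤ n) (hG0 : 0 ≤ R.Gfr 0)
    (hKlam : 0 ≤ P.Klam) {ℓ₁ ℓ₂ cℓ₁ cℓ₂ : ℝ} (hcℓ₁ : 0 ≤ cℓ₁) (hcℓ₂ : 0 ≤ cℓ₂) {Qm x y : TorusSite 2 L}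
    (hresp : ‖klPairAmplitude L M β U μ (klFlowFrameU L M β U μ n) n Qm x y - klPairAmplitude L M β U μ (klFlowFrameU L M β U μ (n - 1)) n Qm x y‖ ≤
      (ℓ₁ + ℓ₂) * frameDist (klFlowFrameU L M β U μ n) (klFlowFrameU L M β U μ (n - 1)))
    (hℓ₁ : ℓ₁ ≤ cℓ₁ * (P.Klam * |U|) / klScale klE0 n) (hℓ₂ : ℓ₂ ≤ cℓ₂ * (P.Klam * U) ^ 2 / klScale klE0 n)
    (hdoor₁ : 1024 * cℓ₁ * R.Gfr 0 ≤ Q.CR * P.Klam) (hdoor₂ : 1024 * cℓ₂ * R.Gfr 0 * |U| ≤ Q.CR) :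
    ‖klPairAmplitude L M β U μ (klFlowFrameU L M β U μ n) n Qm x y - klPairAmplitude L M β U μ (klFlowFrameU L M β U μ (n - 1)) n Qm x y‖ ≤
      frameShiftBar P Q U n := by
  obtain ⟨m, rfl⟩ : ∃ m, n = m + 1 := ⟨n - 1, by omega⟩
  have hh := (histP_klPredsV17F2_iff L M G P Q R β U μ 0 (m + 1)).1 hhist
  have hJ : ∀ k < m + 1, FlowPieceJetsAt L M β U μ R k := fun k hk => ((hh k hk).2.1).2.1
  have hdist := frameDist_klFlowFrameU_succ_le (L := L) (M := M) (β := β) (U := U) (μ := μ) (R := R) (j := m) hJ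
  rw [show m + 1 - 1 = m by omega] at hresp ⊢
  exact hshift_of_frameResponse_orders (P := P) (Q := Q) m hresp hℓ₁ hℓ₂ hdist hG0 hKlam hcℓ₁ hcℓ₂ hdoor₁ hdoor₂

end Model

/-! ## §2 The two doors by name -/

/-- **THE FIRST-ORDER DOOR IS U-FREE AND NEVER BINDING**: at any raise `Q` of `klEngQ8 P R` and for any response numeral `cℓ₁ ≤ 2⁴⁰`,
`1024·cℓ₁·R.Gfr 0 ≤ Q.CR·P.Klam` (`Q.CR ≥ (klEngQ3 P R).CR = 2⁶⁰·Psq²·Rsq²`, `Gfr₀ ≤ Rsq`, `1 ≤ Psq, Rsq, Klam`).  No U-table entry, no render text. -/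
theorem hshift_door_order1_of_le {P : SplitConsts} {R : RenConsts} {Q : EngConsts} {cℓ₁ : ℝ} (hP : P.WF) (hR : R.WF)
    (hQ : (klEngQ8 P R).IsRaiseOf Q) (hc : cℓ₁ ≤ 2 ^ 40) : 1024 * cℓ₁ * R.Gfr 0 ≤ Q.CR * P.Klam := by
  have hG : 0 ≤ R.Gfr 0 := hR.2.2 0
  have hKlam : 1 ≤ P.Klam := hP.1
  have hGr : R.Gfr 0 ≤ klEngRsq R := gfr_le_klEngRsq R (by norm_num)
  have hRsq : 1 ≤ klEngRsq R := one_le_klEngRsq R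
  have hPsq : 1 ≤ klEngPsq P := one_le_klEngPsq P
  have hPsq2 : 1 ≤ klEngPsq P ^ 2 := one_le_pow₀ hPsq
  have hCR : 2 ^ 60 * klEngPsq P ^ 2 * klEngRsq R ^ 2 ≤ Q.CR := by
    have h3 : (klEngQ3 P R).CR = 2 ^ 60 * klEngPsq P ^ 2 * klEngRsq R ^ 2 := rfl
    calc 2 ^ 60 * klEngPsq P ^ 2 * klEngRsq R ^ 2 = (klEngQ3 P R).CR := h3.symm
      _ ≤ (klEngQ5 P R).CR := klEngQ3_CR_le_klEngQ5_CR P R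
      _ = (klEngQ7 P R).CR := by rw [klEngQ7_CR, klEngQ6_CR]
      _ ≤ (klEngQ8 P R).CR := klEngQ7_CR_le_klEngQ8_CR P R
      _ ≤ Q.CR := hQ.CR_le
  calc 1024 * cℓ₁ * R.Gfr 0 ≤ 1024 * 2 ^ 40 * R.Gfr 0 := by gcongr
    _ ≤ 1024 * 2 ^ 40 * klEngRsq R := by gcongr
    _ ≤ 2 ^ 60 * 1 * (klEngRsq R * 1) * 1 := by nlinarith
    _ ≤ 2 ^ 60 * klEngPsq P ^ 2 * (klEngRsq R * klEngRsq R) * P.Klam := by gcongr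
    _ = 2 ^ 60 * klEngPsq P ^ 2 * klEngRsq R ^ 2 * P.Klam := by ring
    _ ≤ Q.CR * P.Klam := mul_le_mul_of_nonneg_right hCR (by linarith)

/-- `klEngU₀4 P R c ≤ klShiftU (2·klHshiftC) = 1/(2¹⁰¹ + 1)` — the second-order door with HALF the budget is still never binding. -/
theorem klEngU₀4_le_klShiftU_two_mul_klHshiftC (P : SplitConsts) (R : RenConsts) (c : ℝ) : klEngU₀4 P R c ≤ klShiftU (2 * klHshiftC) := by
  have e : klShiftU (2 * klHshiftC) = 1 / (2 ^ 101 + 1) := by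
    unfold klShiftU klHshiftC
    rw [max_eq_left (by positivity)]
    norm_num
  rw [e]
  unfold klEngU₀4
  have hp : 1 ≤ klEngPsq P := one_le_klEngPsq P
  have hr : 1 ≤ klEngRsq R := one_le_klEngRsq R
  refine one_div_le_one_div_of_le (by positivity) ?_
  have h4p : 1 ≤ klEngPsq P ^ 4 := one_le_pow₀ hp
  have h4r : 1 ≤ klEngRsq R ^ 4 := one_le_pow₀ hr
  have hc : 1 ≤ c ^ 2 + 1 := by nlinarith [sq_nonneg c]
  calc (2 : ℝ) ^ 101 + 1 ≤ 2 ^ 128 * 1 * 1 * 1 := by norm_num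
    _ ≤ 2 ^ 128 * klEngPsq P ^ 4 * klEngRsq R ^ 4 * (c ^ 2 + 1) := by gcongr

/-- **THE SECOND-ORDER DOOR WITH HALF THE BUDGET at the numeral `klHshiftC`, below `klEngU₀4`** (hence below every U-table of the lineage), at any raise `Q`
of `klEngQ8 P R`: `1024·klHshiftC·R.Gfr 0·|U| ≤ Q.CR`. -/
theorem hshift_door_order2_klHshiftC_of_le_klEngU₀4 {P : SplitConsts} {R : RenConsts} {Q : EngConsts} {U c : ℝ} (hR : R.WF)
    (hQ : (klEngQ8 P R).IsRaiseOf Q) (hU : 0 < U) (hUle : U ≤ klEngU₀4 P R c) : 1024 * klHshiftC * R.Gfr 0 * |U| ≤ Q.CR := by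
  have h := hshift_door_of_le_klShiftU_raise (c := 2 * klHshiftC) (by have := klHshiftC_nonneg; positivity) hR hQ hU
    (hUle.trans (klEngU₀4_le_klShiftU_two_mul_klHshiftC P R c))
  calc 1024 * klHshiftC * R.Gfr 0 * |U| = 512 * (2 * klHshiftC) * R.Gfr 0 * |U| := by ring
    _ ≤ Q.CR := h

end Summit.HubbardSuperconductivity.HubbardSuperconductivity.Theorems.KLRegimeSplit

end
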